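import Literature.AlgebraicGeometry.HodgeTheory.RibetTypeOnePowersHodgeClasses
import Literature.AlgebraicGeometry.Motives.HodgeThetaSubalgebraSymplecticRankFour
import Literature.AlgebraicGeometry.Milne1999.SpecialLefschetzGroupInvariantsSymplecticPowers
import Literature.RepresentationTheory.ClassicalInvariants.TensorLieInvariantsSp
import HarnessLib

/-!
# Hodge classes on all powers of a generic abelian surface are generated by divisor classes
# (Moonen–Zarhin 1999 §2 (2.2) Type I(1) with p. 715: `Hg(X) = Sp(V, φ) ≅ Sp_{4,ℚ}`, hence `B(Xⁿ) = D(Xⁿ)` for all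
# `n` and the Hodge conjecture for all `Xⁿ`) — UNCONDITIONAL, via the Lie step `Lie Hg = 𝔰𝔭₄`, the unipotent
# bridge for `Sp` and the tensor FFT for `Sp`

Family `hodge`, layer `Literature/AlgebraicGeometry/HodgeTheory`. Research context: cell `pub-hodge-ring2` (HONEST
FRAMING: research route conditional on HC_CM; not a corollary; Q11.4-sentence-2 already refuted in dim ≥ 3),
Literature lane, programme R11 «generic abelian surfaces», the geometric half. UNCONDITIONAL; theorems only — no
definition, no named fact (D-0026), no `sorry`. It closes the atlas row «g = 2, Type I(1), End⁰(X) = ℚ» of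
Moonen–Zarhin's table for ALL POWERS, and is the `g = 2` instance of the tree's named fact
`Tankeev1996_hodgeClassesAlgebraic_powers_simple_endRankOne_notEx1` (`2 ∉ Ex(1)`), now a theorem in that case.

THE PRINTED THEOREM. B. Moonen, Yu. Zarhin, *Hodge classes on abelian varieties of low dimension*, Math. Ann.
315 (1999) 711–733 [`paper:arxiv-math_9901113`, held], §2 p. 715 (p0005 L19–L22): "For `g := dim(X) ≤ 3` and
`g = 5` we always find that `Hg(X) = Sp_D(V,φ)`. […] it follows that `B(Xⁿ) = D(Xⁿ)` for all `n`. […] In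
particular the Hodge conjecture is true for all such `Xⁿ`."; (2.2) (p0005 L55–L58): "Type 1(1): `X` is an
abelian surface with `End⁰(X) = ℚ`. Then `Hg(X) = Sp(V,φ) ≅ Sp_{4,ℚ}`."; (1.8) (p0004 L74–L78, Hazama / Murty):
"`Hg(X) = Sp_D(V,φ) ⟺ (X has no factors of type III and D(Xⁿ) = B(Xⁿ) for all n)`". Van Geemen LNM 1594 Thm. 4.2
(Mattuck): the general abelian variety has `B(Xⁿ) = D(Xⁿ)`.

THE PROOF FORMALISED (Lie algebra + invariant theory, as MZ99 (1.8) / Milne 1999 Prop. 3.6 (a)). Data: a complex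
abelian variety `A` whose `H = H¹(A(ℂ); ℚ)` (the tree's Betti universe) has `dim_ℚ H = 4` and `End_Hdg(H) = ℚ`
(for an abelian surface: `finrank_ℚ End⁰(A) = 1`, §4), a polarization `ψ` of `H`, and an abelian variety `B`
with slots `g` over `A` (`AVSlots`: `H¹(B) = ⊕_j g_j^* H¹(A)`, e.g. `B = A^{N+1}`).
* §1 `HodgeStructure.SymplecticTheta.exists_symplecticHodgeBasis` — every polarized weight-one Hodge structure
  has a SYMPLECTIC HODGE BASIS `(f_1,…,f_m, e_1,…,e_m)` of `V_ℂ`: `e_k ∈ V^{1,0}`, `f_k ∈ V^{0,1}`, Gram matrix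
  `ψ_ℂ = J = ((0, -1), (1, 0))` (the second Hodge–Riemann relation as a perfect pairing `V^{0,1} ≅ (V^{1,0})^*`,
  `pairing_bijective`; `V^{1,0}`, `V^{0,1}` are `ψ_ℂ`-isotropic by the first).
* §2 `sum_smul_cupH1_symplecticHodgeBasis_mem_span_rational_oneOne` — the polarization class
  `∑_{s,s'} J_{ss'} cb_s ⌣ cb_{s'} = Λ_ψ(1)` (the `ψ`-Casimir class of the identity, computed in a rational
  basis: a rational class; of type `(1,1)` term by term) lies in `B¹(A) ⊗ ℂ` (Milne Prop. 3.3: the degree-`2`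
  invariant `φ ∈ H ⊗ H`); and THE INVARIANCE THEOREM `AVSlots.exists_symplecticInvariant_coeff`: every rational
  `(p,p)`-class on `B` is `∑_w a(w)·(g cb)_w` for a coefficient function `a` whose slices along every slot word
  are killed by the diagonal derivation of EVERY `X ∈ 𝔰𝔭(Ω)`, `Ω = J` in the letters (THEOREM L-Sp of
  `HodgeThetaSubalgebraSymplecticRankFour`: the rational annihilator Lie algebra of the rational coefficient tensor
  contains `Θ` after complexification, hence is all of `𝔰𝔭(V_ℂ, ψ_ℂ)`; transported to the symplectic letters as
  in the tree's `AVSlots.exists_unitaryInvariant_coeff`).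
* §3 `AVSlots.symplecticHodgeClasses_divisorial`, `AVSlots.isDivisorGenerated_of_endHodge_rat_of_rank_four` — THE
  ASSEMBLY: Lie invariance ⟹ invariance under every `g ∈ Sp(Ω)`
  (`ClassicalInvariants.sum_prod_mul_eq_self_of_forall_wordDerAt_sp_eq_zero`, Goodman–Wallach Thm. 2.2.2:
  `Sp` is generated by root unipotents) ⟹ each slice is a combination of complete contractions of `Ω⁻¹` (tensor
  FFT for `Sp`, Goodman–Wallach Thm. 5.3.3 (2), `mem_span_completeContraction_inv_of_sp_invariant`) ⟹ evaluates
  to `±` products of the crossed classes `∑ Ω⁻¹_{ab} g_s^* v_a ⌣ g_{s'}^* v_b = −(g_s, g_{s'})^*Λ_ψ(1)`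
  (`Milne1999.sum_completeContraction_smul_eq`, `sum_smul_cupPowOne_spPairWord_mem`, Milne Prop. 3.6 (a) with
  Remark 3.7), which are divisor classes by §2 and `Milne1999.sum_smul_cross_mem_span_rational_oneOne`.
* §4 ABELIAN SURFACES WITH `End⁰(A) = ℚ`: `exists_eq_smul_one_of_finrank_endAlgebra_eq_one` (`End_Hdg(H¹) = ℚ` by
  Riemann, `finrank_endAlg_hodge_one`), `AVSlots.isDivisorGenerated_of_surface_endRankOne`,
  `AbelianVariety.isDivisorGenerated_powSucc_of_surface_endRankOne` (`B•(A^{N+1}) = D•(A^{N+1}) ⊗ ℂ`),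
  `hodgeConjectureFor_powSucc_of_surface_endRankOne` (the Hodge conjecture for all powers),
  `hodgeConjectureFor_of_isIsogenous_powSucc_of_surface_endRankOne` (isogeny class), and
  `hodgeClasses_algebraic_powSucc_of_surface_endRankOne` (the `g = 2` instance of the Tankeev fact's content).

NOT here: `g = 3` (MZ99 (2.3): the Lie step needs in addition the exclusion of the `𝔰𝔩₂ × 𝔰𝔬`-type
subalgebras of `𝔰𝔭₆`), simple abelian surfaces of the other types (I(2): `RealMultiplicationPowersHodgeClasses`;
II(1), IV(2,1): not treated here), `Hg = Sp₄` as algebraic groups (only its consequence `B = D` is proved).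

## References

* [MoonenZarhin1999LowDim] B. Moonen, Yu. Zarhin, Math. Ann. 315 (1999) 711–733 = arXiv:math/9901113, §1 (1.8),
  §2 p. 715, (2.2) Type I(1).
* [vanGeemen1994HodgeAV] B. van Geemen, An introduction to the Hodge conjecture for abelian varieties, LNM 1594
  (1994), Thm. 4.2 (Mattuck), §2.4–2.5, Lemma 3.7.
* [Gordon1997] B. B. Gordon, A survey of the Hodge conjecture for abelian varieties, arXiv:alg-geom/9709030, Thm. 7.5
  (Hazama / Murty), §6 (p. 19), Thm. 10.8 (Tankeev).
* [Milne1999LefschetzClasses] J. S. Milne, Lefschetz classes on abelian varieties, Duke Math. J. 96 (1999),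
  Prop. 3.3, Prop. 3.6 (a), Remark 3.7, Cor. 4.5.
* [GoodmanWallachGTM255] R. Goodman, N. R. Wallach, GTM 255 (2009), Thm. 2.2.2, §4.1.1, Thm. 5.3.3 (2), Thm. 5.3.5.
* [Tankeev1996] S. G. Tankeev, Cycles on abelian varieties of prime dimension …, Thm. 1.1 (first case).
* [VoisinHodgeI2002] C. Voisin, Hodge Theory and Complex Algebraic Geometry I, §7.1.2 Def. 7.7, §11.3.1.
* [Deligne1982HodgeCycles] P. Deligne, Hodge cycles on abelian varieties, LNM 900 (1982), I §3, §4 p. 30.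
* [MumfordAV1970] D. Mumford, Abelian Varieties (1970), §1 p. 4, §19–§21.
-/

noncomputable section

open scoped TensorProduct
open scoped Matrix
open CategoryTheory Module

/-! ### §1 Symplectic Hodge bases of a polarized weight-one Hodge structure -/

namespace Literature.AlgebraicGeometry.Motives

namespace HodgeStructure

section SymplecticBasis

universe u

variable {V : Type u} [AddCommGroup V] [Module ℚ V] {n : ℤ}

/-- **The second Hodge–Riemann relation as a perfect pairing `V^{0,1} ≅ (V^{1,0})^*`** for a polarized weight-one
Hodge structure: `q ↦ ψ_ℂ(−, q)` is bijective — injective because `ψ_ℂ(conj q, q) ≠ 0` for `0 ≠ q ∈ V^{0,1}`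
(`Polarization.form_conj_ne_zero`), and `h^{0,1} = h^{1,0}` (Hodge symmetry). The `φ`-free form of the tree's
`UnitaryTheta.pairing_bijective`. [cite: VoisinHodgeI2002, §7.1.2 Def. 7.7] [cite: vanGeemen1994HodgeAV, §2.4] -/
theorem SymplecticTheta.pairing_bijective [Module.Finite ℚ V] (H : HodgeStructure V n) (hn : n = 1)
    (ψ : H.Polarization) :
    Function.Bijective (((ψ.form.baseChange ℂ).domRestrict₁₂ (H.piece 1 0) (H.piece 0 1)).flip :
      ↥(H.piece 0 1) →ₗ[ℂ] Module.Dual ℂ ↥(H.piece 1 0)) := by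
  subst hn
  set S := H.piece 1 0 with hSdef
  set S' := H.piece 0 1 with hS'def
  set Φ := ((ψ.form.baseChange ℂ).domRestrict₁₂ S S').flip with hΦdef
  have hΦ : ∀ (y' : S') (x : S), Φ y' x = ψ.form.baseChange ℂ x y' := fun y' x => by
    rw [hΦdef, LinearMap.flip_apply, LinearMap.domRestrict₁₂_apply]
  have hconj : ∀ y' ∈ S', conj y' ∈ S := fun y' hy' => H.conj_mem_piece hy'
  have hinj : Function.Injective Φ := by
    rw [injective_iff_map_eq_zero]
    intro y' hy'
    have h : ψ.form.baseChange ℂ (conj (y' : ℂ ⊗[ℚ] V)) y' = 0 := by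
      rw [← hΦ y' ⟨_, hconj _ y'.2⟩, hy', LinearMap.zero_apply]
    have h0 : conj (y' : ℂ ⊗[ℚ] V) = 0 := by
      by_contra hne
      refine ψ.form_conj_ne_zero (p := 1) (q := 0) (by norm_num) (hconj _ y'.2) hne ?_
      rw [conj_conj]
      exact h
    exact Subtype.ext (by rw [← conj_conj (y' : ℂ ⊗[ℚ] V), h0, map_zero]; rfl)
  have hdim : Module.finrank ℂ S' = Module.finrank ℂ S := (hodgeNumber_symm_holds H 1 0).symm
  exact ⟨hinj, (LinearMap.injective_iff_surjective_of_finrank_eq_finrank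
    (hdim.trans (Subspace.dual_finrank_eq (K := ℂ) (V := ↥S)).symm)).1 hinj⟩

/-- **Symplectic Hodge bases.** An effective polarized `ℚ`-Hodge structure `H` of weight `1` has a basis
`cb = (f_1,…,f_m, e_1,…,e_m)` of `V_ℂ` (`m = h^{1,0}`; `f_k = cb(inl k)`, `e_k = cb(inr k)`) with `e_k ∈ V^{1,0}`,
`f_k ∈ V^{0,1}` and Gram matrix `ψ_ℂ(cb_s, cb_{s'}) = J_{ss'}`, `J = ((0,−1),(1,0))` (`Matrix.J`): i.e.
`ψ_ℂ(e_i, f_j) = δ_{ij}`, `ψ_ℂ(e_i, e_j) = ψ_ℂ(f_i, f_j) = 0`. Construction: a basis `e` of `V^{1,0}`, its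
`ψ_ℂ`-dual basis `f` of `V^{0,1}` (`pairing_bijective`); `V^{1,0}`, `V^{0,1}` are isotropic (first Hodge–Riemann
relation, `Polarization.form_piece_piece`); independence because `J` is invertible, and `2m = dim V`
(`V_ℂ = V^{1,0} ⊕ V^{0,1}`). (Van Geemen 2.4–2.5: "`V_ℂ = V^{1,0} ⊕ V^{0,1}` … `E` restricted to `V^{1,0}` is
zero"; Goodman–Wallach §1.1.2: every nondegenerate skew form has a basis with matrix `J`.)
[cite: vanGeemen1994HodgeAV, §2.4–2.5] [cite: VoisinHodgeI2002, §7.1.2 Def. 7.7]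
[cite: GoodmanWallachGTM255, §1.1.2 (Lemma 1.1.5) and §2.1.2] -/
theorem SymplecticTheta.exists_symplecticHodgeBasis [Module.Finite ℚ V] [HodgeTensorFacts.{u, u}]
    (H : HodgeStructure V n) (hn : n = 1) (heff : H.IsEffective) (ψ : H.Polarization) :
    ∃ cb : Module.Basis (Fin (Module.finrank ℂ ↥(H.piece 1 0)) ⊕ Fin (Module.finrank ℂ ↥(H.piece 1 0))) ℂ
        (ℂ ⊗[ℚ] V),
      (∀ k, cb (Sum.inr k) ∈ H.piece 1 0) ∧ (∀ k, cb (Sum.inl k) ∈ H.piece 0 1) ∧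
      ∀ s s', ψ.form.baseChange ℂ (cb s) (cb s') =
        Matrix.J (Fin (Module.finrank ℂ ↥(H.piece 1 0))) ℂ s s' := by
  classical
  subst hn
  obtain ⟨Θ, hΘ⟩ := exists_hodgeTheta H
  obtain ⟨hP, hQ, hΘ10, hΘ01, -⟩ := UnitaryTheta.theta_facts H rfl heff hΘ
  set ψC := ψ.form.baseChange ℂ with hψC
  have hswap : ∀ x y, ψC y x = -ψC x y := fun x y => by
    rw [hψC, ψ.form_baseChange_swap, show (1 : ℤ).negOnePow = -1 from Int.negOnePow_one]
    simp
  have hPP : ∀ x ∈ H.piece 1 0, ∀ y ∈ H.piece 1 0, ψC x y = 0 := fun x hx y hy =>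
    ψ.form_piece_piece (p := 1) (p' := 1) (by norm_num) (by simpa using hx) (by simpa using hy)
  have hQQ : ∀ x ∈ H.piece 0 1, ∀ y ∈ H.piece 0 1, ψC x y = 0 := fun x hx y hy =>
    ψ.form_piece_piece (p := 0) (p' := 0) (by norm_num) (by simpa using hx) (by simpa using hy)
  set P := H.piece 1 0 with hPdef
  set Q := H.piece 0 1 with hQdef
  set m := Module.finrank ℂ ↥P with hm
  -- a basis `e` of `V^{1,0}` and its `ψ_ℂ`-dual basis `f` of `V^{0,1}`
  set bP : Module.Basis (Fin m) ℂ ↥P := Module.finBasis ℂ ↥P with hbPdef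
  set Φ := LinearEquiv.ofBijective _ (SymplecticTheta.pairing_bijective H rfl ψ) with hΦdef
  have hΦ : ∀ (y' : ↥Q) (x : ↥P), Φ y' x = ψC x y' := fun y' x => by
    rw [hΦdef, LinearEquiv.ofBijective_apply, LinearMap.flip_apply, LinearMap.domRestrict₁₂_apply]
  set fb : Module.Basis (Fin m) ℂ ↥Q := bP.dualBasis.map Φ.symm with hfbdef
  have hfb : ∀ i (x : ↥P), ψC x (fb i) = bP.repr x i := fun i x => by
    rw [← hΦ, hfbdef, Module.Basis.map_apply, LinearEquiv.apply_symm_apply, Module.Basis.dualBasis_apply]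
  -- the family `(f, e)` and its Gram matrix `J`
  set cbf : Fin m ⊕ Fin m → ℂ ⊗[ℚ] V :=
    Sum.elim (fun i => (fb i : ℂ ⊗[ℚ] V)) (fun i => (bP i : ℂ ⊗[ℚ] V)) with hcbfdef
  have hinl : ∀ i, cbf (Sum.inl i) = fb i := fun i => rfl
  have hinr : ∀ i, cbf (Sum.inr i) = bP i := fun i => rfl
  have hgram : ∀ s s', ψC (cbf s) (cbf s') = Matrix.J (Fin m) ℂ s s' := by
    rintro (i | i) (j | j)
    · rw [hinl, hinl, Matrix.J, Matrix.fromBlocks_apply₁₁, Matrix.zero_apply]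
      exact hQQ _ (fb i).2 _ (fb j).2
    · rw [hinl, hinr, Matrix.J, Matrix.fromBlocks_apply₁₂, Matrix.neg_apply, Matrix.one_apply, hswap, hfb,
        Module.Basis.repr_self, Finsupp.single_apply]
      by_cases h : i = j
      · subst h; simp
      · rw [if_neg (Ne.symm h), if_neg h]
    · rw [hinr, hinl, Matrix.J, Matrix.fromBlocks_apply₂₁, Matrix.one_apply, hfb, Module.Basis.repr_self,
        Finsupp.single_apply]
    · rw [hinr, hinr, Matrix.J, Matrix.fromBlocks_apply₂₂, Matrix.zero_apply]
      exact hPP _ (bP i).2 _ (bP j).2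
  -- linear independence (the Gram matrix is invertible) and the count `2m = dim V`
  have hli : LinearIndependent ℂ cbf := by
    rw [Fintype.linearIndependent_iff]
    intro c hc
    have hvec : Matrix.vecMul c (Matrix.J (Fin m) ℂ) = 0 := by
      funext s'
      have h := congrArg (fun z => ψC z (cbf s')) hc
      simp only [map_sum, map_smul, LinearMap.sum_apply, LinearMap.smul_apply, smul_eq_mul, hgram, map_zero,
        LinearMap.zero_apply] at h
      exact h
    have h0 := Matrix.eq_zero_of_vecMul_eq_zero (Matrix.isUnit_det_J (Fin m) ℂ).ne_zero hvec
    exact fun s => congr_fun h0 s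
  have hcard : Fintype.card (Fin m ⊕ Fin m) = Module.finrank ℂ (ℂ ⊗[ℚ] V) := by
    have hPQ : ∀ v, (2 : ℂ)⁻¹ • (v + Θ v) + (2 : ℂ)⁻¹ • (v - Θ v) = v := fun v => by module
    have hsup : P ⊔ Q = ⊤ := by
      rw [eq_top_iff]
      intro v _
      rw [← hPQ v]
      exact Submodule.add_mem_sup (hP v) (hQ v)
    have hinf : P ⊓ Q = ⊥ := by
      rw [eq_bot_iff]
      intro x hx
      rw [Submodule.mem_bot]
      have h1 := hΘ10 x hx.1
      rw [hΘ01 x hx.2, neg_eq_iff_add_eq_zero, ← two_smul ℂ x, smul_eq_zero] at h1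
      exact h1.resolve_left (two_ne_zero' ℂ)
    have hsum := Submodule.finrank_sup_add_finrank_inf_eq P Q
    rw [hsup, hinf, finrank_top, finrank_bot, add_zero] at hsum
    have hsymm : Module.finrank ℂ ↥P = Module.finrank ℂ ↥Q := hodgeNumber_symm_holds H 1 0
    rw [Fintype.card_sum, Fintype.card_fin, hsum, ← hsymm, ← hm]
  set cb : Module.Basis (Fin m ⊕ Fin m) ℂ (ℂ ⊗[ℚ] V) := basisOfLinearIndependentOfCardEqFinrank' cbf hli hcard
    with hcbdef
  have hcb : ⇑cb = cbf := coe_basisOfLinearIndependentOfCardEqFinrank' cbf hli hcard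
  refine ⟨cb, fun k => ?_, fun k => ?_, fun s s' => ?_⟩
  · rw [hcb, hinr]; exact (bP k).2
  · rw [hcb, hinl]; exact (fb k).2
  · rw [hcb]; exact hgram s s'

end SymplecticBasis

end HodgeStructure

end Literature.AlgebraicGeometry.Motives

/-! ### §2 The polarization class of a symplectic Hodge basis, and the invariance theorem: slices of the
coefficient function of a Hodge class are killed by `𝔰𝔭(Ω)` -/

namespace Literature.AlgebraicGeometry.HodgeTheory

open Literature.AlgebraicTopology.SingularHomology
open Literature.AlgebraicGeometry.Motives (IsSmoothProjective AbelianVariety bettiCohomology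
  ofRatClassBaseChange ofRatClassBaseChange_tmul HodgeTensorFacts hodgeTensorFacts_holds)
open Literature.Barriers.HodgeConjecture
open Literature.AlgebraicGeometry.Motives.HodgeStructure
open Literature.RepresentationTheory.GeneralLinear
open Literature.RepresentationTheory.ClassicalInvariants
open Literature.NumberTheory.DiophantineGeometry

section Casimir

variable {A : AbelianVariety ℂ}

/-- **The polarization class of a symplectic Hodge basis is a rational `(1,1)`-class**: for a symplectic Hodge
basis `cb` of `H¹(A; ℚ) ⊗ ℂ` (`cb(inr k) ∈ H^{1,0}`, `cb(inl k) ∈ H^{0,1}`, Gram matrix `J`),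
`∑_{s,s'} J_{ss'} ρ(cb_s) ⌣ ρ(cb_{s'}) = ∑_k (ρ(e_k) ⌣ ρ(f_k) − ρ(f_k) ⌣ ρ(e_k)) ∈ B¹(A) ⊗ ℂ`. Proof: the
`ψ_ℂ`-dual family of `cb` is `d'_j = ∑_s J_{sj} cb_s` (`Jᵀ J = 1`), so the sum is the `ψ`-Casimir class
`Λ_ψ(1)` of the identity (`casimirClass`, `sum_dual_eq_sum_dual`), which computed in a rational basis is a
rational class (`isRationalClass_casimirClass_baseChange`); it has type `(1,1)` term by term (`J_{ss'} ≠ 0` only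
for letters of opposite Hodge types). Milne Prop. 3.3: the form `φ ∈ (H ⊗ H)^{Sp}` is the class of a divisor.
[cite: Milne1999LefschetzClasses, Prop. 3.3 (p. 652) and §3 p. 654] [cite: GoodmanWallachGTM255, §4.1.1]
[cite: VoisinHodgeI2002, §7.1.1 and §11.3.1] -/
theorem sum_smul_cupH1_symplecticHodgeBasis_mem_span_rational_oneOne [HodgeTensorFacts.{0, 0}]
    (hHD : exists_isReal_hodgeModel) (hI : hodgePQ_independent_of_hodgeModel)
    (ψ : (BettiUniverse.hodge hHD (AbelianVariety.isSmoothProjective_holds (A := A)) 1).Polarization)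
    {m : ℕ} (cb : Module.Basis (Fin m ⊕ Fin m) ℂ (ℂ ⊗[ℚ] bettiCohomology A.X 1))
    (hcb10 : ∀ k, cb (Sum.inr k) ∈
      (BettiUniverse.hodge hHD (AbelianVariety.isSmoothProjective_holds (A := A)) 1).piece 1 0)
    (hcb01 : ∀ k, cb (Sum.inl k) ∈
      (BettiUniverse.hodge hHD (AbelianVariety.isSmoothProjective_holds (A := A)) 1).piece 0 1)
    (hgram : ∀ s s', ψ.form.baseChange ℂ (cb s) (cb s') = Matrix.J (Fin m) ℂ s s') :
    (∑ s, ∑ s', Matrix.J (Fin m) ℂ s s' • cupH1 A (cb s) (cb s')) ∈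
      Submodule.span ℂ {c : complexBetti A.X 2 | IsRationalClass c ∧ IsOfHodgeType A.dim A.X 2 1 1 c} := by
  classical
  have hX : IsSmoothProjective A.dim A.X := AbelianVariety.isSmoothProjective_holds
  haveI : Module.Finite ℚ (bettiCohomology A.X 1) := finite_bettiCohomology_one A
  set Ψ := ψ.form.baseChange ℂ with hΨ
  -- the `ψ_ℂ`-dual family `d'_j = ∑_s J_{sj} cb_s` of `cb`
  set d' : Fin m ⊕ Fin m → ℂ ⊗[ℚ] bettiCohomology A.X 1 := fun j => ∑ s, Matrix.J (Fin m) ℂ s j • cb s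
    with hd'
  have hJJ : ∀ j k, ∑ s, Matrix.J (Fin m) ℂ s j * Matrix.J (Fin m) ℂ s k = if j = k then 1 else 0 := by
    intro j k
    have h : ∑ s, Matrix.J (Fin m) ℂ s j * Matrix.J (Fin m) ℂ s k =
        ((Matrix.J (Fin m) ℂ)ᵀ * Matrix.J (Fin m) ℂ) j k := by
      rw [Matrix.mul_apply]
      rfl
    rw [h, Matrix.J_transpose, neg_mul, Matrix.J_squared, neg_neg, Matrix.one_apply]
  have hdual' : ∀ j k, Ψ (d' j) (cb k) = if k = j then 1 else 0 := by
    intro j k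
    simp only [hd', map_sum, map_smul, LinearMap.sum_apply, LinearMap.smul_apply, smul_eq_mul, hgram]
    rw [hJJ j k]
    by_cases h : j = k
    · subst h; simp
    · rw [if_neg h, if_neg (Ne.symm h)]
  have hsep : ∀ y, (∀ j, Ψ (d' j) y = 0) → y = 0 := by
    intro y hy
    have hvec : Matrix.vecMul (fun s => Ψ (cb s) y) (Matrix.J (Fin m) ℂ) = 0 := by
      funext j
      have h := hy j
      simp only [hd', map_sum, map_smul, LinearMap.sum_apply, LinearMap.smul_apply, smul_eq_mul] at h
      rw [Finset.sum_congr rfl fun s _ => mul_comm (Matrix.J (Fin m) ℂ s j) (Ψ (cb s) y)] at h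
      exact h
    have h0 := Matrix.eq_zero_of_vecMul_eq_zero (Matrix.isUnit_det_J (Fin m) ℂ).ne_zero hvec
    have hb : ∀ s, Ψ (cb s) y = 0 := fun s => by
      have h := congr_fun h0 s
      simpa using h
    refine ψ.eq_zero_of_forall_form_eq_zero' fun x => ?_
    rw [← cb.sum_repr x, map_sum, LinearMap.sum_apply]
    exact Finset.sum_eq_zero fun s _ => by rw [map_smul, LinearMap.smul_apply, ← hΨ, hb, smul_zero]
  -- the Casimir class of the identity in a rational basis: rational, and equal to the sum
  set eQ := Module.finBasis ℚ (bettiCohomology A.X 1) with heQ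
  have hrat : IsRationalClass (casimirClass A ψ.form ψ.nondegenerate eQ 1) := by
    have h := isRationalClass_casimirClass_baseChange ψ.form ψ.nondegenerate eQ 1
    rwa [LinearMap.baseChange_one] at h
  have hcas : casimirClass A ψ.form ψ.nondegenerate eQ 1 =
      ∑ s, ∑ s', Matrix.J (Fin m) ℂ s s' • cupH1 A (cb s) (cb s') := by
    rw [casimirClass_apply, sum_dual_eq_sum_dual Ψ (cupH1 A) _ _
      (eq_sum_formBaseChange_smul_dualBasis ψ.form ψ.nondegenerate eQ) (⇑cb) d' hdual' hsep 1, Finset.sum_comm]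
    refine Finset.sum_congr rfl fun s' _ => ?_
    simp only [hd', Module.End.one_apply, map_sum, map_smul, LinearMap.sum_apply, LinearMap.smul_apply]
  -- Hodge type `(1,1)`, term by term
  have hcup := BettiUniverse.cupPreservesHodgeType hHD hI hX
  obtain ⟨Mh⟩ := nonempty_hodgeModel_holds hX
  have htype : IsOfHodgeType A.dim A.X 2 1 1 (∑ s, ∑ s', Matrix.J (Fin m) ℂ s s' • cupH1 A (cb s) (cb s')) := by
    refine IsOfHodgeType.sum hX Mh _ _ fun s _ => IsOfHodgeType.sum hX Mh _ _ fun s' _ => ?_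
    rcases s with i | i <;> rcases s' with j | j
    · rw [Matrix.J, Matrix.fromBlocks_apply₁₁, Matrix.zero_apply, zero_smul]
      exact IsOfHodgeType.zero Mh 2 1 1
    · refine IsOfHodgeType.smul ?_ _
      rw [cupH1_apply]
      have h01 := (BettiUniverse.mem_hodge_piece_iff hHD hI hX (k := 1) (p := 0) (q := 1) rfl _).1 (hcb01 i)
      have h10 := (BettiUniverse.mem_hodge_piece_iff hHD hI hX (k := 1) (p := 1) (q := 0) rfl _).1 (hcb10 j)
      have h' : IsOfHodgeType A.dim A.X 2 (0 + 1) (1 + 0) _ := hcup (rfl : 1 + 1 = 2) h01 h10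
      exact h'
    · refine IsOfHodgeType.smul ?_ _
      rw [cupH1_apply]
      have h10 := (BettiUniverse.mem_hodge_piece_iff hHD hI hX (k := 1) (p := 1) (q := 0) rfl _).1 (hcb10 i)
      have h01 := (BettiUniverse.mem_hodge_piece_iff hHD hI hX (k := 1) (p := 0) (q := 1) rfl _).1 (hcb01 j)
      have h' : IsOfHodgeType A.dim A.X 2 (1 + 0) (0 + 1) _ := hcup (rfl : 1 + 1 = 2) h10 h01
      exact h'
    · rw [Matrix.J, Matrix.fromBlocks_apply₂₂, Matrix.zero_apply, zero_smul]
      exact IsOfHodgeType.zero Mh 2 1 1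
  refine Submodule.subset_span ⟨?_, htype⟩
  rw [← hcas]
  exact hrat

end Casimir

section Invariance

variable {A B : AbelianVariety ℂ} {n : ℕ} {g : Fin n → (B ⟶ A)}

open scoped Classical in
/-- **THE INVARIANCE THEOREM (MZ99 (2.2) with (1.8), Lie step, for abelian varieties with slots over `A` of
generic rank-four type).** Let `A` be a complex abelian variety whose `H = H¹(A(ℂ); ℚ)` has `dim_ℚ H = 4` and
`End_Hdg(H) = ℚ`, with a polarization `ψ` and a symplectic Hodge basis `cb` (`exists_symplecticHodgeBasis`),
read in letters `Fin M` through `e : Fin m ⊕ Fin m ≃ Fin M` (Gram matrix `Ω = J` reindexed), and `B` an abelian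
variety with slots `g` over `A`. Then every rational `(p,p)`-class `c` on `B` (`p ≥ 1`) is `∑_w a(w)·(g cb)_w`
for a coefficient function `a` on words in the letters `(j, i)` (slot, letter) such that for every slot word `U`
and EVERY `X ∈ 𝔰𝔭(Ω)` (`Xᵀ Ω + Ω X = 0`) the diagonal derivation of `X` kills the slice `a(U, −)`: the operator
`Y_X` of `H_ℂ` with matrix `X` in the letters is `ψ_ℂ`-skew, so THEOREM L-Sp
(`HodgeStructure.SymplecticTheta.wordDerAt_eq_zero_of_skew`: the rational annihilator of the rational coefficient
tensor is an admissible Lie algebra containing `Θ` after complexification, hence all of `𝔰𝔭(H_ℂ, ψ_ℂ)` since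
`Lie Hg = 𝔰𝔭₄`) applies; the transport between symplectic and rational letters is that of the tree's
`AVSlots.exists_unitaryInvariant_coeff`. MZ99 p. 715: "`Hg(X) = Sp_D(V,φ)` […] it follows that
`B(Xⁿ) = D(Xⁿ)` for all `n`". [cite: MoonenZarhin1999LowDim, §2 (2.2), p. 715 and §1 (1.8)]
[cite: Gordon1997, Thm. 7.5 and §6 (p. 19)] [cite: vanGeemen1994HodgeAV, Thm. 4.2] -/
theorem AVSlots.exists_symplecticInvariant_coeff [HodgeTensorFacts.{0, 0}] (hg : AVSlots A B g)
    (hHD : exists_isReal_hodgeModel) (hI : hodgePQ_independent_of_hodgeModel)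
    (ψ : (BettiUniverse.hodge hHD (AbelianVariety.isSmoothProjective_holds (A := A)) 1).Polarization)
    (hE : ∀ a ∈ (BettiUniverse.hodge hHD (AbelianVariety.isSmoothProjective_holds (A := A)) 1).endAlg,
      ∃ x : ℚ, a = x • 1)
    (hV : Module.finrank ℚ (bettiCohomology A.X 1) = 4)
    {m M : ℕ} (cb : Module.Basis (Fin m ⊕ Fin m) ℂ (ℂ ⊗[ℚ] bettiCohomology A.X 1)) (e : Fin m ⊕ Fin m ≃ Fin M)
    (hcb10 : ∀ k, cb (Sum.inr k) ∈
      (BettiUniverse.hodge hHD (AbelianVariety.isSmoothProjective_holds (A := A)) 1).piece 1 0)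
    (hcb01 : ∀ k, cb (Sum.inl k) ∈
      (BettiUniverse.hodge hHD (AbelianVariety.isSmoothProjective_holds (A := A)) 1).piece 0 1)
    (hgram : ∀ s s', ψ.form.baseChange ℂ (cb s) (cb s') = Matrix.J (Fin m) ℂ s s')
    {p : ℕ} (hp : 0 < p) {c : complexBetti B.X (2 * p)} (hcQ : IsRationalClass c)
    (hc : IsOfHodgeType B.dim B.X (2 * p) p p c) :
    ∃ a : (Fin (2 * p) → Fin n × Fin M) → ℂ,
      wordEval (cupPowOneAlt ℂ (Motives.ComplexPoints B.X) (2 * p))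
        (avLetters g fun i : Fin M => ofRatClassBaseChange (Motives.ComplexPoints A.X) 1 (cb (e.symm i))) a = c ∧
      ∀ (U : Fin (2 * p) → Fin n) (X : Matrix (Fin M) (Fin M) ℂ),
        Xᵀ * Matrix.reindex e e (Matrix.J (Fin m) ℂ) + Matrix.reindex e e (Matrix.J (Fin m) ℂ) * X = 0 →
        wordDerAt ℂ (fun _ : Fin (2 * p) => X) (wordSlice a U) = 0 := by
  classical
  -- the setting
  have hX : IsSmoothProjective A.dim A.X := AbelianVariety.isSmoothProjective_holds
  haveI : Module.Finite ℚ (bettiCohomology A.X 1) := finite_bettiCohomology_one A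
  have hn1 : (((1 : ℕ) : ℤ)) = 1 := Nat.cast_one
  have heff := BettiUniverse.hodge_isEffective hHD hX 1
  set F := cupPowOneAlt ℂ (Motives.ComplexPoints B.X) (2 * p) with hFdef
  have hFinj : Function.Injective (exteriorPower.alternatingMapLinearEquiv F) :=
    injective_alternatingMapLinearEquiv_cupPowOneAlt B (2 * p)
  -- bases indexed by `Fin M`: the symplectic Hodge basis `cbσ` and a rational basis `eC`
  set cbσ : Module.Basis (Fin M) ℂ (ℂ ⊗[ℚ] bettiCohomology A.X 1) := cb.reindex e with hcbσdef
  have hcbσ : ∀ i, cbσ i = cb (e.symm i) := fun i => by rw [hcbσdef, Module.Basis.reindex_apply]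
  have hM : Module.finrank ℚ (bettiCohomology A.X 1) = M := by
    have h := Module.finrank_eq_card_basis cbσ
    rwa [Module.finrank_baseChange, Fintype.card_fin] at h
  set eQ : Module.Basis (Fin M) ℚ (bettiCohomology A.X 1) := Module.finBasisOfFinrankEq ℚ _ hM with heQ
  set eC : Module.Basis (Fin M) ℂ (ℂ ⊗[ℚ] bettiCohomology A.X 1) := Algebra.TensorProduct.basis ℂ eQ with heC
  -- kinds of the letters: `inl ↦ f ∈ H^{0,1}` (kind `1`), `inr ↦ e ∈ H^{1,0}` (kind `0`)
  set κ' : Fin M → Fin 2 := fun i => Sum.elim (fun _ => (1 : Fin 2)) (fun _ => 0) (e.symm i) with hκ'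
  have hkind : ∀ i,
      (κ' i = 0 ∧ cbσ i ∈ (BettiUniverse.hodge hHD (AbelianVariety.isSmoothProjective_holds (A := A)) 1).piece 1 0) ∨
      (κ' i = 1 ∧ cbσ i ∈ (BettiUniverse.hodge hHD (AbelianVariety.isSmoothProjective_holds (A := A)) 1).piece 0 1) := by
    intro i
    rw [hcbσ]
    simp only [hκ']
    rcases e.symm i with k | k
    · exact Or.inr ⟨rfl, hcb01 k⟩
    · exact Or.inl ⟨rfl, hcb10 k⟩
  have hkind0 : ∀ i, κ' i = 0 →
      cbσ i ∈ (BettiUniverse.hodge hHD (AbelianVariety.isSmoothProjective_holds (A := A)) 1).piece 1 0 := by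
    intro i hi
    rcases hkind i with h | h
    · exact h.2
    · rw [h.1] at hi; exact absurd hi (by decide)
  have hkind1 : ∀ i, κ' i = 1 →
      cbσ i ∈ (BettiUniverse.hodge hHD (AbelianVariety.isSmoothProjective_holds (A := A)) 1).piece 0 1 := by
    intro i hi
    rcases hkind i with h | h
    · rw [h.1] at hi; exact absurd hi (by decide)
    · exact h.2
  -- letters
  set ρ := ofRatClassBaseChangeEquiv hX 1 with hρ
  set v : Module.Basis _ ℂ (complexBetti A.X 1) := cbσ.map ρ with hv
  set eL : Module.Basis _ ℂ (complexBetti A.X 1) := eC.map ρ with heL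
  have heLQ : ∀ i, IsRationalClass (eL i) := fun i => by
    rw [heL, Module.Basis.map_apply, heC, Algebra.TensorProduct.basis_apply, hρ,
      ofRatClassBaseChangeEquiv_apply, ofRatClassBaseChange_tmul, one_smul]
    exact isRationalClass_ofRatClass _
  have hv_apply : ∀ i, v i = ofRatClassBaseChange (Motives.ComplexPoints A.X) 1 (cb (e.symm i)) := fun i => by
    rw [hv, Module.Basis.map_apply, hcbσ, hρ, ofRatClassBaseChangeEquiv_apply]
  have hv0 : ∀ i, κ' i = 0 → IsOfHodgeType A.dim A.X 1 1 0 (v i) := by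
    intro i hi
    rw [hv, Module.Basis.map_apply, hρ, ofRatClassBaseChangeEquiv_apply,
      ← BettiUniverse.mem_hodge_piece_iff hHD hI hX (k := 1) (p := 1) (q := 0) rfl]
    exact hkind0 i hi
  have hv1 : ∀ i, κ' i = 1 → IsOfHodgeType A.dim A.X 1 0 1 (v i) := by
    intro i hi
    rw [hv, Module.Basis.map_apply, hρ, ofRatClassBaseChangeEquiv_apply,
      ← BettiUniverse.mem_hodge_piece_iff hHD hI hX (k := 1) (p := 0) (q := 1) rfl]
    exact hkind1 i hi
  -- (α) an antisymmetric kind-balanced coefficient function in the letters `g_j^* cbσ_i`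
  obtain ⟨ax, hax_bal, hax_anti, hcax⟩ := hg.exists_antisymm_kindBalanced_wordEval_eq v κ' hv0 hv1 hp hc
  -- the change of letters to the rational letters
  set G : Matrix _ _ ℂ := eC.toMatrix cbσ with hG
  set G' : Matrix _ _ ℂ := cbσ.toMatrix eC with hG'
  have hG'G : G' * G = 1 := cbσ.toMatrix_mul_toMatrix_flip eC
  have hve : ∀ i, v i = ∑ i', G i' i • eL i' := fun i => by
    simp only [hv, heL, Module.Basis.map_apply, ← map_smul, ← map_sum]
    congr 1
    exact (eC.sum_toMatrix_smul_self (v := ⇑cbσ) (j := i)).symm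
  have hletters : ∀ j i, avLetters g v (j, i) = ∑ i', G i' i • avLetters g eL (j, i') :=
    avLetters_baseChange g G hve
  set aE := colourChangeAt (fun _ : Fin n => G) ax with haE
  have haE_anti : IsAntisymm aE := hax_anti.colourChangeAt _
  have hcaE : wordEval F (avLetters g eL) aE = c := by
    rw [haE, ← wordEval_eq_wordEval_colourChangeAt F (fun _ : Fin n => G) hletters ax, hcax]
  -- rationality of `aE`
  obtain ⟨q, hq⟩ := hg.exists_rat_wordEval_eq eL heLQ hcQ
  obtain ⟨q', -, haEq⟩ := haE_anti.exists_eq_algebraMap_of_wordEval_eq hFinj (hg.letterBasis eL)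
    (q := q) (by rw [AVSlots.coe_letterBasis, hcaE, hFdef, hq])
  have hslice_e : ∀ u, wordSlice aE u = wordRepAt ℂ (fun _ : Fin (2 * p) => G) (wordSlice ax u) :=
    fun u => wordSlice_colourChangeAt (fun _ : Fin n => G) ax u
  -- the Hodge operator `Θ`: `diag(±1)` in the letters
  obtain ⟨Θ, hΘ⟩ := exists_hodgeTheta (BettiUniverse.hodge hHD (AbelianVariety.isSmoothProjective_holds (A := A)) 1)
  obtain ⟨-, -, hΘ10, hΘ01, -⟩ :=
    UnitaryTheta.theta_facts (BettiUniverse.hodge hHD (AbelianVariety.isSmoothProjective_holds (A := A)) 1)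
      hn1 heff hΘ
  have hΘb : ∀ i, Θ (cbσ i) = (if κ' i = 0 then (1 : ℂ) else -1) • cbσ i := by
    intro i
    rcases hkind i with ⟨h0, hmem⟩ | ⟨h1', hmem⟩
    · rw [h0, if_pos rfl, one_smul]
      exact hΘ10 _ hmem
    · rw [h1', if_neg one_ne_zero, neg_one_smul]
      exact hΘ01 _ hmem
  have hΘcb : LinearMap.toMatrix cbσ cbσ Θ = kindDiag κ' := by
    ext i i'
    rw [LinearMap.toMatrix_apply, hΘb, map_smul, Module.Basis.repr_self, Finsupp.smul_apply,
      Finsupp.single_apply, kindDiag, Matrix.diagonal_apply, smul_eq_mul, mul_ite, mul_one, mul_zero]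
    by_cases hii : i = i'
    · subst hii; rw [if_pos rfl]
    · rw [if_neg (Ne.symm hii), if_neg hii]
  have hJG : LinearMap.toMatrix eC eC Θ * G = G * kindDiag κ' := by
    rw [← hΘcb, hG, linearMap_toMatrix_mul_basis_toMatrix, basis_toMatrix_mul_linearMap_toMatrix]
  have hΘq : ∀ u : Fin (2 * p) → Fin n, wordDerAt ℂ (fun _ : Fin (2 * p) => LinearMap.toMatrix eC eC Θ)
      (wordSlice (fun w => algebraMap ℚ ℂ (q' w)) u) = 0 := by
    intro u
    rw [← haEq, hslice_e]
    refine wordDerAt_wordRepAt_eq_zero_of_mul_eq ℂ (fun _ : Fin (2 * p) => G) (fun _ => hJG) ?_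
    rw [wordDerAt_const]
    exact wordDer_kindDiag_wordSlice_eq_zero κ' hax_bal u
  -- the Gram matrix `Ω = J` of `ψ_ℂ` in the letters `Fin M`
  set ψC := ψ.form.baseChange ℂ with hψC
  set Ω : Matrix (Fin M) (Fin M) ℂ := Matrix.reindex e e (Matrix.J (Fin m) ℂ) with hΩdef
  have hΩ : ∀ i i', ψC (cbσ i) (cbσ i') = Ω i i' := fun i i' => by
    rw [hcbσ, hcbσ, hgram, hΩdef, Matrix.reindex_apply, Matrix.submatrix_apply]
  -- the invariance of every slice under `𝔰𝔭(Ω)`, via THEOREM L-Sp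
  have key : ∀ X : Matrix (Fin M) (Fin M) ℂ, Xᵀ * Ω + Ω * X = 0 → ∀ u : Fin (2 * p) → Fin n,
      wordDerAt ℂ (fun _ : Fin (2 * p) => X) (wordSlice ax u) = 0 := by
    intro X hXΩ u
    set Y := Matrix.toLin cbσ cbσ X with hYdef
    have hYcb : ∀ i, Y (cbσ i) = ∑ r, X r i • cbσ r := fun i => Matrix.toLin_self cbσ cbσ X i
    have hYskew : ∀ x y, ψC (Y x) y + ψC x (Y y) = 0 := by
      have hB : ψC ∘ₗ Y + ψC.compl₂ Y = 0 := by
        refine LinearMap.BilinForm.ext_basis cbσ fun i i' => ?_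
        rw [LinearMap.add_apply, LinearMap.add_apply, LinearMap.comp_apply, LinearMap.compl₂_apply,
          LinearMap.zero_apply, LinearMap.zero_apply, hYcb, hYcb, map_sum, LinearMap.sum_apply, map_sum]
        simp only [map_smul, LinearMap.smul_apply, smul_eq_mul, hΩ]
        have h := congr_fun (congr_fun hXΩ i) i'
        simp only [Matrix.add_apply, Matrix.mul_apply, Matrix.zero_apply, Matrix.transpose_apply] at h
        rw [Finset.sum_congr rfl fun r _ => mul_comm (X r i') (Ω i r)]
        exact h
      intro x y
      have h := LinearMap.congr_fun (LinearMap.congr_fun hB x) y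
      simpa only [LinearMap.add_apply, LinearMap.comp_apply, LinearMap.compl₂_apply, LinearMap.zero_apply]
        using h
    have hL := SymplecticTheta.wordDerAt_eq_zero_of_skew
      (BettiUniverse.hodge hHD (AbelianVariety.isSmoothProjective_holds (A := A)) 1) hn1 heff ψ hE hV eQ q' hΘ
      hΘq hYskew u
    rw [← haEq, hslice_e] at hL
    have hYG : ∀ _t : Fin (2 * p), LinearMap.toMatrix eC eC Y * G = G * LinearMap.toMatrix cbσ cbσ Y :=
      fun _ => by rw [hG, linearMap_toMatrix_mul_basis_toMatrix, basis_toMatrix_mul_linearMap_toMatrix]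
    have hblk : LinearMap.toMatrix cbσ cbσ Y = X := by
      rw [hYdef, LinearMap.toMatrix_toLin]
    have h3 : wordRepAt ℂ (fun _ : Fin (2 * p) => G)
        (wordDerAt ℂ (fun _ : Fin (2 * p) => X) (wordSlice ax u)) = 0 := by
      rw [← hblk, wordRepAt_wordDerAt_of_mul_eq ℂ (fun _ : Fin (2 * p) => G) hYG, hL]
    exact wordRepAt_injective ℂ (g := fun _ : Fin (2 * p) => G) (g' := fun _ : Fin (2 * p) => G')
      (funext fun _ => hG'G) (by rw [h3, map_zero])
  -- conclusion
  have hvfun : (⇑v : Fin M → complexBetti A.X 1) =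
      fun i => ofRatClassBaseChange (Motives.ComplexPoints A.X) 1 (cb (e.symm i)) := funext hv_apply
  refine ⟨ax, ?_, fun U X hXΩ => key X hXΩ U⟩
  rw [← hvfun]
  exact hcax

end Invariance

/-! ### §3 The assembly: `Bᵖ(B) ⊆ Dᵖ(B) ⊗ ℂ` by the unipotent bridge for `Sp`, the tensor FFT for `Sp` and
the polarization class -/

section Assembly

variable {A B : AbelianVariety ℂ} {n : ℕ} {g : Fin n → (B ⟶ A)}

open scoped Classical in
/-- **`Bᵖ(B) ⊆ Dᵖ(B) ⊗ ℂ` for an abelian variety `B` with slots over `A` of generic rank-four type** (data as in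
`exists_symplecticInvariant_coeff`). Every rational `(p,p)`-class on `B` is a `ℂ`-combination of products of
`p` rational `(1,1)`-classes: the slices of its coefficient function are killed by `𝔰𝔭(Ω)`
(`exists_symplecticInvariant_coeff`), hence fixed by every `h ∈ Sp(Ω)`
(`ClassicalInvariants.sum_prod_mul_eq_self_of_forall_wordDerAt_sp_eq_zero`, Goodman–Wallach Thm. 2.2.2: `Sp`
is generated by root unipotents), hence combinations of complete contractions of `Ω⁻¹` (tensor FFT for `Sp`,
Goodman–Wallach Thm. 5.3.3 (2), `mem_span_completeContraction_inv_of_sp_invariant`), each of which evaluates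
on the letters to `±` a product of crossed classes `∑_{a,b} Ω⁻¹_{ab} g_s^* v_a ⌣ g_{s'}^* v_b`
(`Milne1999.sum_completeContraction_smul_eq`, `Milne1999.sum_smul_cupPowOne_spPairWord_mem`; Milne Prop. 3.6 (a)
with Remark 3.7: "`(⋀^*(rH))^G = k[(⊗² rH)^G]` all `r ≥ 1`, (a) `G = Sp(φ)`"), and these are divisor classes:
`Ω⁻¹ = −Ω`, so the crossed class is `−(g_s, g_{s'})^*` of the polarization class of §2
(`Milne1999.sum_smul_cross_mem_span_rational_oneOne`, Milne Prop. 3.3). MZ99 (1.8): "`Hg(X) = Sp_D(V,φ) ⟺ …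
D(Xⁿ) = B(Xⁿ) for all n`". [cite: MoonenZarhin1999LowDim, §1 (1.8) and §2 p. 715]
[cite: Milne1999LefschetzClasses, Prop. 3.3, Prop. 3.6 (a), Remark 3.7 (pp. 652–656)]
[cite: GoodmanWallachGTM255, Thm. 2.2.2, Thm. 5.3.3 (2) and Thm. 5.3.5] -/
theorem AVSlots.symplecticHodgeClasses_divisorial [HodgeTensorFacts.{0, 0}] (hg : AVSlots A B g)
    (hHD : exists_isReal_hodgeModel) (hI : hodgePQ_independent_of_hodgeModel)
    (ψ : (BettiUniverse.hodge hHD (AbelianVariety.isSmoothProjective_holds (A := A)) 1).Polarization)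
    (hE : ∀ a ∈ (BettiUniverse.hodge hHD (AbelianVariety.isSmoothProjective_holds (A := A)) 1).endAlg,
      ∃ x : ℚ, a = x • 1)
    (hV : Module.finrank ℚ (bettiCohomology A.X 1) = 4)
    {m M : ℕ} (cb : Module.Basis (Fin m ⊕ Fin m) ℂ (ℂ ⊗[ℚ] bettiCohomology A.X 1)) (e : Fin m ⊕ Fin m ≃ Fin M)
    (hcb10 : ∀ k, cb (Sum.inr k) ∈
      (BettiUniverse.hodge hHD (AbelianVariety.isSmoothProjective_holds (A := A)) 1).piece 1 0)
    (hcb01 : ∀ k, cb (Sum.inl k) ∈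
      (BettiUniverse.hodge hHD (AbelianVariety.isSmoothProjective_holds (A := A)) 1).piece 0 1)
    (hgram : ∀ s s', ψ.form.baseChange ℂ (cb s) (cb s') = Matrix.J (Fin m) ℂ s s')
    (p : ℕ) (c : complexBetti B.X (2 * p)) (hcQ : IsRationalClass c)
    (hc : IsOfHodgeType B.dim B.X (2 * p) p p c) :
    c ∈ divisorClassesSpan B.X B.dim p := by
  classical
  rcases Nat.eq_zero_or_pos p with rfl | hp
  · exact AbelianVariety.mem_divisorClassesSpan_zero B c
  obtain ⟨a, hca, hkill⟩ := hg.exists_symplecticInvariant_coeff hHD hI ψ hE hV cb e hcb10 hcb01 hgram hp hcQ hc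
  set v' : Fin M → complexBetti A.X 1 :=
    fun i : Fin M => ofRatClassBaseChange (Motives.ComplexPoints A.X) 1 (cb (e.symm i)) with hv'
  have hv'apply : ∀ i, v' i = ofRatClassBaseChange (Motives.ComplexPoints A.X) 1 (cb (e.symm i)) := fun i => rfl
  set y : Fin n × Fin M → complexBetti B.X 1 := avLetters g v' with hy
  set F := cupPowOneAlt ℂ (Motives.ComplexPoints B.X) (2 * p) with hF
  -- the Gram matrix `Ω = J` in the letters: alternating, nondegenerate, `Ω⁻¹ = -Ω`
  set Ω : Matrix (Fin M) (Fin M) ℂ := Matrix.reindex e e (Matrix.J (Fin m) ℂ) with hΩdef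
  have hΩapply : ∀ i i', Ω i i' = Matrix.J (Fin m) ℂ (e.symm i) (e.symm i') := fun i i' => by
    rw [hΩdef, Matrix.reindex_apply, Matrix.submatrix_apply]
  have hΩt : ∀ i i', Ω i' i = -Ω i i' := fun i i' => by
    rw [hΩapply, hΩapply]
    have h := congr_fun (congr_fun (Matrix.J_transpose (Fin m) ℂ) (e.symm i)) (e.symm i')
    rw [Matrix.transpose_apply, Matrix.neg_apply] at h
    exact h
  have hΩa : (Matrix.toBilin' Ω).IsAlt := isAlt_toBilin'_of_forall_eq_neg hΩt
  have hΩdet : Ω.det ≠ 0 := by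
    rw [hΩdef, Matrix.det_reindex_self]
    exact (Matrix.isUnit_det_J (Fin m) ℂ).ne_zero
  have hΩn : (Matrix.toBilin' Ω).Nondegenerate :=
    LinearMap.BilinForm.nondegenerate_toBilin'_iff_det_ne_zero.2 hΩdet
  have hΩinv : Ω⁻¹ = -Ω := by
    rw [hΩdef, Matrix.inv_reindex, Matrix.J_inv]
    ext i j
    simp only [Matrix.reindex_apply, Matrix.submatrix_apply, Matrix.neg_apply]
  have hanti : ∀ a₁ a₂, Ω⁻¹ a₂ a₁ = -Ω⁻¹ a₁ a₂ := fun a₁ a₂ => by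
    rw [hΩinv, Matrix.neg_apply, Matrix.neg_apply, hΩt a₁ a₂]
  -- the crossed classes are divisor classes: `∑ Ω⁻¹_{ab} v_a ⌣ v_b = -Λ_ψ(1) ∈ B¹(A) ⊗ ℂ`
  have hθ := sum_smul_cupH1_symplecticHodgeBasis_mem_span_rational_oneOne hHD hI ψ cb hcb10 hcb01 hgram
  have hθA : (∑ a₁, ∑ a₂, Ω⁻¹ a₁ a₂ • cupProduct (rfl : 1 + 1 = 2) (v' a₁) (v' a₂)) ∈
      Submodule.span ℂ {c : complexBetti A.X 2 | IsRationalClass c ∧ IsOfHodgeType A.dim A.X 2 1 1 c} := by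
    have hre : ∑ a₁, ∑ a₂, Ω⁻¹ a₁ a₂ • cupProduct (rfl : 1 + 1 = 2) (v' a₁) (v' a₂) =
        -∑ s, ∑ s', Matrix.J (Fin m) ℂ s s' • cupH1 A (cb s) (cb s') := by
      rw [hΩinv, ← Finset.sum_neg_distrib, ← e.sum_comp]
      refine Fintype.sum_congr _ _ fun s => ?_
      rw [← Finset.sum_neg_distrib, ← e.sum_comp]
      refine Fintype.sum_congr _ _ fun s' => ?_
      rw [Matrix.neg_apply, hΩapply, hv'apply, hv'apply, e.symm_apply_apply, e.symm_apply_apply, neg_smul,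
        cupH1_apply]
    rw [hre]
    exact Submodule.neg_mem _ hθ
  -- every slice is an `Sp(Ω)`-invariant tensor (the unipotent bridge)
  have hinv : ∀ (t : Fin (2 * p) → Fin n) (h : Matrix (Fin M) (Fin M) ℂ), hᵀ * Ω * h = Ω →
      ∀ w' : Word M (2 * p), (∑ w, (∏ q, h (w' q) (w q)) * wordSlice a t w) = wordSlice a t w' :=
    fun t h hh w' => sum_prod_mul_eq_self_of_forall_wordDerAt_sp_eq_zero e (fun X hX => hkill t X hX) hh w'
  -- slice by slice: the tensor FFT for `Sp` and the evaluation of the complete contractions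
  rw [← hca, wordEval_eq_sum_wordSlice]
  refine Submodule.sum_mem _ fun t _ => ?_
  have hmem := mem_span_completeContraction_inv_of_sp_invariant hΩa hΩn (wordSlice a t) (hinv t)
  set Λ := Fintype.linearCombination ℂ (fun ε : Word M (2 * p) => F (fun q => y (t q, ε q))) with hΛ
  have hΛapply : ∀ cf : Word M (2 * p) → ℂ, Λ cf = ∑ ε, cf ε • F (fun q => y (t q, ε q)) :=
    fun cf => Fintype.linearCombination_apply ℂ _ cf
  rw [← hΛapply]
  refine (Submodule.span_le (p := (divisorClassesSpan B.X B.dim p).comap Λ)).2 ?_ hmem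
  rintro _ ⟨e', rfl⟩
  rw [SetLike.mem_coe, Submodule.mem_comap, hΛapply]
  obtain ⟨π, -, hsum⟩ := Milne1999.sum_completeContraction_smul_eq F Ω⁻¹ e' y t
  rw [hsum]
  refine Submodule.smul_mem _ _ ?_
  simp_rw [hF, cupPowOneAlt_apply]
  refine Milne1999.sum_smul_cupPowOne_spPairWord_mem Ω⁻¹ y p _ _ fun c' => ?_
  simp only [hy, avLetters_apply]
  exact Milne1999.sum_smul_cross_mem_span_rational_oneOne (g _) (g _) v' Ω⁻¹ hanti hθA

/-- **`IsDivisorGenerated B` (the tree's spelling of `B•(B) = D•(B) ⊗ ℂ`) for every abelian variety `B` with slots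
over a complex abelian variety `A` with `dim_ℚ H¹(A; ℚ) = 4` and `End_Hdg(H¹(A; ℚ)) = ℚ`** — the symplectic
Hodge basis of §1 read in the letters `Fin (m + m)` feeds `symplecticHodgeClasses_divisorial`. MZ99 (2.2) with
p. 715: "`Hg(X) = Sp(V,φ) ≅ Sp_{4,ℚ}`", "`B(Xⁿ) = D(Xⁿ)` for all `n`". [cite: MoonenZarhin1999LowDim, §2 (2.2) and p. 715]
[cite: vanGeemen1994HodgeAV, Thm. 4.2] [cite: Milne1999LefschetzClasses, Prop. 3.6 (a) and Cor. 4.5] -/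
theorem AVSlots.isDivisorGenerated_of_endHodge_rat_of_rank_four [HodgeTensorFacts.{0, 0}] (hg : AVSlots A B g)
    (hHD : exists_isReal_hodgeModel) (hI : hodgePQ_independent_of_hodgeModel)
    (ψ : (BettiUniverse.hodge hHD (AbelianVariety.isSmoothProjective_holds (A := A)) 1).Polarization)
    (hE : ∀ a ∈ (BettiUniverse.hodge hHD (AbelianVariety.isSmoothProjective_holds (A := A)) 1).endAlg,
      ∃ x : ℚ, a = x • 1)
    (hV : Module.finrank ℚ (bettiCohomology A.X 1) = 4) : IsDivisorGenerated B := by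
  classical
  haveI : Module.Finite ℚ (bettiCohomology A.X 1) := finite_bettiCohomology_one A
  have hX : IsSmoothProjective A.dim A.X := AbelianVariety.isSmoothProjective_holds
  have heff := BettiUniverse.hodge_isEffective hHD hX 1
  obtain ⟨cb, hcb10, hcb01, hgram⟩ := SymplecticTheta.exists_symplecticHodgeBasis
    (BettiUniverse.hodge hHD (AbelianVariety.isSmoothProjective_holds (A := A)) 1) Nat.cast_one heff ψ
  exact fun p c hcQ hc =>
    hg.symplecticHodgeClasses_divisorial hHD hI ψ hE hV cb finSumFinEquiv hcb10 hcb01 hgram p c hcQ hc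

end Assembly

/-! ### §4 Abelian surfaces with `End⁰(A) = ℚ`: all powers, the Hodge conjecture, the isogeny class -/

section Surface

variable {A B : AbelianVariety ℂ} {n : ℕ} {g : Fin n → (B ⟶ A)}

/-- **`End_Hdg(H¹(A; ℚ)) = ℚ` when `finrank_ℚ End⁰(A) = 1`** (`End_Hdg(H¹) ≅ End⁰(A)ᵒᵖ` by Riemann,
`finrank_endAlg_hodge_one`; a one-dimensional algebra containing `1 ≠ 0` is `ℚ · 1`). MZ99 (2.2) Type I(1):
"`End⁰(X) = ℚ`". [cite: MoonenZarhin1999LowDim, §2 (2.2)] [cite: MumfordAV1970, §19–§21]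
[cite: Deligne1982HodgeCycles, §4 (p. 30)] -/
theorem exists_eq_smul_one_of_finrank_endAlgebra_eq_one (hHD : exists_isReal_hodgeModel)
    (hI : hodgePQ_independent_of_hodgeModel) (h1 : Module.finrank ℚ A.endAlgebra = 1) (hA : 0 < A.dim) :
    ∀ a ∈ (BettiUniverse.hodge hHD (AbelianVariety.isSmoothProjective_holds (A := A)) 1).endAlg,
      ∃ x : ℚ, a = x • 1 := by
  classical
  intro a ha
  haveI : Module.Finite ℚ (bettiCohomology A.X 1) := finite_bettiCohomology_one A
  haveI : Nontrivial (bettiCohomology A.X 1) := by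
    apply Module.nontrivial_of_finrank_pos (R := ℚ)
    rw [finrank_bettiCohomology_one A]
    omega
  set E := (BettiUniverse.hodge hHD (AbelianVariety.isSmoothProjective_holds (A := A)) 1).endAlg with hEdef
  have hErank : Module.finrank ℚ ↥E = 1 := by rw [hEdef, finrank_endAlg_hodge_one hHD hI, h1]
  have h1ne : (⟨1, E.one_mem⟩ : ↥E) ≠ 0 := by
    intro h
    have h' : ((⟨1, E.one_mem⟩ : ↥E) : Module.End ℚ (bettiCohomology A.X 1)) = 0 := by rw [h]; rfl
    exact one_ne_zero h'
  obtain ⟨x, hx⟩ := (finrank_eq_one_iff_of_nonzero' (⟨1, E.one_mem⟩ : ↥E) h1ne).1 hErank ⟨a, ha⟩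
  refine ⟨x, ?_⟩
  have h := congrArg Subtype.val hx
  simpa using h.symm

/-- **`B•(B) = D•(B) ⊗ ℂ` for every abelian variety `B` with slots over an abelian SURFACE `A` with
`End⁰(A) = ℚ` (`finrank_ℚ End⁰(A) = 1`) — UNCONDITIONAL.** Assembled from
`AVSlots.isDivisorGenerated_of_endHodge_rat_of_rank_four`: `dim_ℚ H¹(A; ℚ) = 2·dim A = 4`
(`finrank_bettiCohomology_one`), `End_Hdg(H¹) = ℚ` (`exists_eq_smul_one_of_finrank_endAlgebra_eq_one`), a
polarization of `H¹(A(ℂ); ℚ)` (`smoothProjective_hodgeStructure_isPolarizable_holds`), and the tree's own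
`exists_isReal_hodgeModel_holds`, `hodgePQ_independent_of_hodgeModel_holds`, `hodgeTensorFacts_holds`.
MZ99 (2.2) Type I(1). [cite: MoonenZarhin1999LowDim, §2 (2.2) and p. 715] [cite: vanGeemen1994HodgeAV, Thm. 4.2] -/
theorem AVSlots.isDivisorGenerated_of_surface_endRankOne (hg : AVSlots A B g)
    (h1 : Module.finrank ℚ A.endAlgebra = 1) (hdim : A.dim = 2) : IsDivisorGenerated B := by
  classical
  have hHD : exists_isReal_hodgeModel := exists_isReal_hodgeModel_holds
  have hI : hodgePQ_independent_of_hodgeModel := hodgePQ_independent_of_hodgeModel_holds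
  haveI : HodgeTensorFacts.{0, 0} := hodgeTensorFacts_holds.{0, 0}
  have hX : IsSmoothProjective A.dim A.X := AbelianVariety.isSmoothProjective_holds
  obtain ⟨ψ⟩ : (BettiUniverse.hodge hHD (AbelianVariety.isSmoothProjective_holds (A := A)) 1).IsPolarizable :=
    smoothProjective_hodgeStructure_isPolarizable_holds hX (BettiUniverse.realHodgeModel hHD hX)
      (BettiUniverse.realHodgeModel_isHodgeSymmetric hHD hX) 1
  have hV : Module.finrank ℚ (bettiCohomology A.X 1) = 4 := by rw [finrank_bettiCohomology_one A, hdim]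
  exact hg.isDivisorGenerated_of_endHodge_rat_of_rank_four hHD hI ψ
    (exists_eq_smul_one_of_finrank_endAlgebra_eq_one hHD hI h1 (by omega)) hV

/-- **`Lie Hg(A) = 𝔰𝔭(H¹(A; ℚ), ψ)` for an abelian surface with `End⁰(A) = ℚ`** — Moonen–Zarhin 1999 (2.2) Type
I(1) "`Hg(X) = Sp(V,φ) ≅ Sp_{4,ℚ}`" in Lie form, for EVERY polarization `ψ` of `H¹(A(ℂ); ℚ)`: an endomorphism of
`H¹(A; ℚ)` lies in the Lie algebra of the Hodge group iff it is `ψ`-skew (the tree's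
`SymplecticTheta.mem_hodgeLie_iff_skew` with `dim_ℚ H¹ = 4` and `End_Hdg(H¹) = ℚ`; the instance `HodgeTensorFacts` is
the tree's `hodgeTensorFacts_holds`). [cite: MoonenZarhin1999LowDim, §2 (2.2)] [cite: Gordon1997, §1.6.2 and Thm. 7.5] -/
theorem mem_hodgeLie_iff_skew_of_surface_endRankOne [HodgeTensorFacts.{0, 0}] (hHD : exists_isReal_hodgeModel)
    (hI : hodgePQ_independent_of_hodgeModel) (h1 : Module.finrank ℚ A.endAlgebra = 1) (hdim : A.dim = 2)
    (ψ : (BettiUniverse.hodge hHD (AbelianVariety.isSmoothProjective_holds (A := A)) 1).Polarization)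
    (X : Module.End ℚ (bettiCohomology A.X 1)) :
    X ∈ (BettiUniverse.hodge hHD (AbelianVariety.isSmoothProjective_holds (A := A)) 1).hodgeLie ↔
      ∀ v w, ψ.form (X v) w + ψ.form v (X w) = 0 := by
  haveI : Module.Finite ℚ (bettiCohomology A.X 1) := finite_bettiCohomology_one A
  have hX : IsSmoothProjective A.dim A.X := AbelianVariety.isSmoothProjective_holds
  have hV : Module.finrank ℚ (bettiCohomology A.X 1) = 4 := by rw [finrank_bettiCohomology_one A, hdim]
  exact SymplecticTheta.mem_hodgeLie_iff_skew _ Nat.cast_one (BettiUniverse.hodge_isEffective hHD hX 1) ψ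
    (exists_eq_smul_one_of_finrank_endAlgebra_eq_one hHD hI h1 (by omega)) hV X

end Surface

/-- **Moonen–Zarhin 1999 (2.2) Type I(1) with p. 715, all powers — UNCONDITIONAL: `B•(A^{N+1}) = D•(A^{N+1}) ⊗ ℂ`**
for a complex abelian surface `A` with `End⁰(A) = ℚ` (`finrank_ℚ End⁰(A) = 1`): "`Hg(X) = Sp(V,φ) ≅ Sp_{4,ℚ}`",
"it follows that `B(Xⁿ) = D(Xⁿ)` for all `n`". Van Geemen Thm. 4.2 (Mattuck) for `g = 2`.
[cite: MoonenZarhin1999LowDim, §2 (2.2) and p. 715] [cite: vanGeemen1994HodgeAV, Thm. 4.2] -/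
theorem AbelianVariety.isDivisorGenerated_powSucc_of_surface_endRankOne (A : AbelianVariety ℂ)
    (h1 : Module.finrank ℚ A.endAlgebra = 1) (hdim : A.dim = 2) (N : ℕ) : IsDivisorGenerated (A.powSucc N) :=
  (AVSlots.powSucc A N).isDivisorGenerated_of_surface_endRankOne h1 hdim

/-- `A` itself: `B•(A) = D•(A) ⊗ ℂ` for an abelian surface with `End⁰(A) = ℚ`.
[cite: MoonenZarhin1999LowDim, §2 (2.2)] -/
theorem AbelianVariety.isDivisorGenerated_of_surface_endRankOne (A : AbelianVariety ℂ)
    (h1 : Module.finrank ℚ A.endAlgebra = 1) (hdim : A.dim = 2) : IsDivisorGenerated A :=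
  (avSlots_self A).isDivisorGenerated_of_surface_endRankOne h1 hdim

/-- **The Hodge conjecture for all powers `A^{N+1}` of a complex abelian surface with `End⁰(A) = ℚ` —
UNCONDITIONAL** (`B = D` above with Lefschetz `(1,1)`: the tree's `hodgeConjectureFor_of_isDivisorGenerated`).
MZ99 p. 715: "In particular the Hodge conjecture is true for all such `Xⁿ`."
[cite: MoonenZarhin1999LowDim, §2 p. 715 and (2.2)] [cite: vanGeemen1994HodgeAV, Thm. 4.2 and §2.4] -/
theorem hodgeConjectureFor_powSucc_of_surface_endRankOne (A : AbelianVariety ℂ)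
    (h1 : Module.finrank ℚ A.endAlgebra = 1) (hdim : A.dim = 2) (N : ℕ) :
    HodgeConjectureFor (A.powSucc N).dim (A.powSucc N).X :=
  hodgeConjectureFor_of_isDivisorGenerated _
    (AbelianVariety.isDivisorGenerated_powSucc_of_surface_endRankOne A h1 hdim N)

/-- **The Hodge conjecture for `A` itself**, an abelian surface with `End⁰(A) = ℚ` (`N = 0`-free spelling; for a
surface this is of course Lefschetz `(1,1)` alone). [cite: MoonenZarhin1999LowDim, §2 (2.2)] -/
theorem hodgeConjectureFor_of_surface_endRankOne (A : AbelianVariety ℂ)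
    (h1 : Module.finrank ℚ A.endAlgebra = 1) (hdim : A.dim = 2) : HodgeConjectureFor A.dim A.X :=
  hodgeConjectureFor_of_isDivisorGenerated _ (AbelianVariety.isDivisorGenerated_of_surface_endRankOne A h1 hdim)

/-- **The Hodge conjecture for every complex abelian variety isogenous to a power of an abelian surface with
`End⁰(A) = ℚ`** (van Geemen Lemma 3.7 = the tree's `HodgeConjectureFor.of_isIsogenous`).
[cite: vanGeemen1994HodgeAV, Lemma 3.7 and Thm. 4.2] [cite: MoonenZarhin1999LowDim, §2 (2.2)] -/
theorem hodgeConjectureFor_of_isIsogenous_powSucc_of_surface_endRankOne {A B' : AbelianVariety ℂ}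
    (h1 : Module.finrank ℚ A.endAlgebra = 1) (hdim : A.dim = 2) {N : ℕ} (hB : B'.IsIsogenous (A.powSucc N)) :
    HodgeConjectureFor B'.dim B'.X :=
  HodgeConjectureFor.of_isIsogenous hB (hodgeConjectureFor_powSucc_of_surface_endRankOne A h1 hdim N)

/-- **The `g = 2` instance of the content of the named fact
`Tankeev1996_hodgeClassesAlgebraic_powers_simple_endRankOne_notEx1`** (`TankeevExceptionalNumbersHodgeClasses`:
"on every power of a simple complex abelian variety `A` with `End⁰(A) = ℚ` whose dimension is not in `Ex(1)`,
every rational `(m,m)`-class is algebraic"; `2 ∉ Ex(1) = {4^l, ½ C(4l+2,2l+1)^{2m−1}, 2^{8lm+4l−4m−3},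
4^l (m+1)^{2l+1} : l, m ≥ 1}`), now a THEOREM for `dim A = 2` (simplicity is not needed as a hypothesis).
[cite: Tankeev1996, Thm. 1.1 (first case)] [cite: Gordon1997, Thm. 10.8] [cite: MoonenZarhin1999LowDim, §2 (2.2)] -/
theorem hodgeClasses_algebraic_powSucc_of_surface_endRankOne (A : AbelianVariety ℂ)
    (h1 : Module.finrank ℚ A.endAlgebra = 1) (hdim : A.dim = 2) (N m : ℕ)
    (c : complexBetti (A.powSucc N).X (2 * m)) (hc : IsRationalClass c)
    (hmm : IsOfHodgeType (A.powSucc N).dim (A.powSucc N).X (2 * m) m m c) :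
    c ∈ algebraicClasses (A.powSucc N).X m :=
  (hodgeConjectureFor_powSucc_of_surface_endRankOne A h1 hdim N).2 m c hc hmm

end Literature.AlgebraicGeometry.HodgeTheory

end
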